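import Summits.BirchSwinnertonDyer.BirchSwinnertonDyer.Theorems.BiquadraticEisensteinDescentHeegnerTwistCouplingInSupplySymbolicMonskyEvenDesignDoor
import Summits.BirchSwinnertonDyer.BirchSwinnertonDyer.Theorems.BiquadraticEisensteinDescentHeegnerTwistCouplingInSupplySymbolicMonskyEvenDesignMuOne
import HarnessLib

set_option linter.dupNamespace false -- `Summit.BirchSwinnertonDyer.BirchSwinnertonDyer.Theorems.…` (summit = sub)
set_option autoImplicit false

/-!
# Crux `HeegnerTwistCouplingInSupply` (stmt-BirchSwinnertonDyer-21381) — EVEN bases with AT MOST ONE prime `≡ 7 (mod 8)`: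
# at `δ = 1` the `0 × V` section of the even pencil never obstructs (conjecture (★) on this family)

Route `BiquadraticEisensteinDescent` (cell `pub/bsd-wall`, width seat `bsd-wall-cm-bed-w3` g25; `--supports` 21381, helper). Generalises
`…SymbolicMonskyEvenDesignNoSeven` (p759259) from «no prime `≡ 7 (mod 8)`» to «at most one prime `≡ 7 (mod 8)`» (index `b₇`; hypothesis
`[(-1/P_b) = −1] ∧ [(2/P_b) = +1] → b = b₇`, no restriction when no such prime exists). The swap mechanism is unchanged: the single class-7
coordinate of the core vector `u` (`u|_D = 0`, `⟨m,u⟩ = 0`) vanishes by the parity `⟨m,u⟩ = 0`, all other coordinates on `M` being class-3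
coordinates, hence in `D`. With two primes `≡ 7 (mod 8)` the count is one short.
* `swap_mem_evenPencil_one_inf_ker_snd_of_one_seven` — if `(0,u) ∈ W_ev(1)` with `⟨m,u⟩ = ⟨d,u⟩ = 0` then `(u,0) ∈ W_ev(1)`;
* ★★ `two_mul_finrank_evenPencil_one_inf_ker_fst_le_of_one_seven` — `2·dim (W_ev(1) ∩ 0×V) ≤ dim 𝒦_ev + 1`.
Numerics (w3 g25 probe32.py): 3 020 even bases with exactly one prime `≡ 7 (mod 8)`, K ≤ 10, 0 failures. Companion `…EvenDesignOneSevenDiag`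
(diagonal section), doors in `…EvenDesignOneSevenDoorIff`. HONEST FRAMING: RUNG-LEVEL corner layer; `𝔽₂`-linear algebra attached to Monsky
matrices [cite: HeathBrown1994SelmerCongruentII, Appendix (Monsky), typescript p. 41 L20–L36]; the crux as stated (C⁺), its registered stubs and
BSD are NOT touched; nothing is closed. THEOREMS ONLY.
-/

namespace Summit.BirchSwinnertonDyer.BirchSwinnertonDyer.Theorems.SymbolicMonsky

section OneSevenEven

open Module Matrix Literature.NumberTheory.EllipticCurves Literature.NumberTheory.EllipticCurves.HeathBrown1994
  Literature.NumberTheory.EllipticCurves.HeathBrown1994.Families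
open Literature.NumberTheory.EllipticCurves.Rank1Residual

variable {k : ℕ} (base : SymbData (k + 1))

/-- Column sums of the Laplacian: `Σ_i Σ_j [(P_j/P_i) = −1](y_j + y_i) = (1 + μ)⟨m,y⟩` (quadratic reciprocity `bz_neg_swap`). [folklore] -/
private theorem sum_lap_eq_one_add_mu_mul₇ (y : Fin (k + 1) → ZMod 2) :
    (∑ i, ∑ j, bz (base.neg i j) * (y j + y i)) =
      (1 + ∑ b, bz (negNegOne (base.cls b))) * ∑ j, bz (negNegOne (base.cls j)) * y j := by
  have h2 : ∀ x : ZMod 2, x + x = 0 := by decide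
  have hsq : ∀ x : ZMod 2, x * x = x := by decide
  have e1 : (∑ i, ∑ j, bz (base.neg i j) * (y j + y i)) = ∑ i, ∑ j, (bz (base.neg j i) + bz (base.neg i j)) * y i := by
    have : (∑ i, ∑ j, bz (base.neg i j) * (y j + y i)) = (∑ i, ∑ j, bz (base.neg i j) * y j) + ∑ i, ∑ j, bz (base.neg i j) * y i := by
      rw [← Finset.sum_add_distrib]
      refine Finset.sum_congr rfl fun i _ => ?_
      rw [← Finset.sum_add_distrib]
      exact Finset.sum_congr rfl fun j _ => by ring
    rw [this, Finset.sum_comm, ← Finset.sum_add_distrib]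
    refine Finset.sum_congr rfl fun i _ => ?_
    rw [← Finset.sum_add_distrib]
    exact Finset.sum_congr rfl fun j _ => by ring
  have e2 : ∀ i, (∑ j, (bz (base.neg j i) + bz (base.neg i j)) * y i) =
      (∑ j, bz (negNegOne (base.cls i)) * bz (negNegOne (base.cls j)) * y i) + bz (negNegOne (base.cls i)) * y i := by
    intro i
    have hpt : ∀ j, (bz (base.neg j i) + bz (base.neg i j)) * y i =
        bz (negNegOne (base.cls i)) * bz (negNegOne (base.cls j)) * y i + (if j = i then bz (negNegOne (base.cls i)) * y i else 0) := by
      intro j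
      by_cases hji : j = i
      · subst hji
        rw [if_pos rfl]
        linear_combination (h2 (bz (base.neg j j))) * y j - (hsq (bz (negNegOne (base.cls j)))) * y j -
          h2 (bz (negNegOne (base.cls j)) * y j)
      · have hij : i ≠ j := fun h => hji h.symm
        rw [if_neg hji, base.bz_neg_swap hij, bz_and_mul]
        linear_combination (h2 (bz (base.neg i j))) * y i
    rw [Finset.sum_congr rfl fun j _ => hpt j, Finset.sum_add_distrib, Finset.sum_ite_eq' Finset.univ i]
    simp only [Finset.mem_univ, if_true]
  rw [e1, Finset.sum_congr rfl fun i _ => e2 i, Finset.sum_add_distrib, add_mul, one_mul, Finset.mul_sum]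
  have e3 : ∀ i, (∑ j, bz (negNegOne (base.cls i)) * bz (negNegOne (base.cls j)) * y i) =
      (∑ b, bz (negNegOne (base.cls b))) * (bz (negNegOne (base.cls i)) * y i) := by
    intro i
    rw [Finset.sum_mul]
    exact Finset.sum_congr rfl fun j _ => by ring
  rw [Finset.sum_congr rfl fun i _ => e3 i, add_comm]

/-- An even root-number-`−1` base (`Σ_b [P_b ≡ 3 (4)] = 1` in `𝔽₂`) has some prime `≡ 3 (mod 4)`. -/
private theorem exists_negNegOne_of_sum_eq_one₇ (hμ : (∑ b, bz (negNegOne (base.cls b))) = 1) :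
    ∃ b₀, negNegOne (base.cls b₀) = true := by
  obtain ⟨b₀, -, hb₀⟩ := Finset.exists_ne_zero_of_sum_ne_zero
    (by rw [hμ]; exact one_ne_zero : (∑ b, bz (negNegOne (base.cls b))) ≠ 0)
  refine ⟨b₀, ?_⟩
  cases h : negNegOne (base.cls b₀) with
  | true => rfl
  | false => rw [h] at hb₀; exact absurd (by decide : bz false = 0) hb₀

/-- Cutting a subspace by one linear functional costs at most one dimension. -/
private theorem finrank_le_finrank_inf_ker_add_one₇ {Z : Type*} [AddCommGroup Z] [Module (ZMod 2) Z] [FiniteDimensional (ZMod 2) Z]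
    (C : Submodule (ZMod 2) Z) (f : Z →ₗ[ZMod 2] ZMod 2) :
    finrank (ZMod 2) ↥C ≤ finrank (ZMod 2) ↥(C ⊓ LinearMap.ker f) + 1 := by
  have h1 := Submodule.finrank_sup_add_finrank_inf_eq C (LinearMap.ker f)
  have h2 := LinearMap.finrank_range_add_finrank_ker f
  have h3 : finrank (ZMod 2) ↥(LinearMap.range f) ≤ 1 := by
    have := Submodule.finrank_le (LinearMap.range f)
    rwa [Module.finrank_self] at this
  have h4 : finrank (ZMod 2) ↥(C ⊔ LinearMap.ker f) ≤ finrank (ZMod 2) Z := Submodule.finrank_le _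
  omega

/-- Elements of the even pencil at `δ = 1`: `(v + γ·1, u)` for an even kernel pair `(u, v)` and `γ ∈ 𝔽₂`. -/
private theorem mem_evenPencil_one_iff₇ (p : (Fin (k + 1) → ZMod 2) × (Fin (k + 1) → ZMod 2)) :
    p ∈ base.evenPencil (fun _ => 1) ↔
      ∃ (u v : Fin (k + 1) → ZMod 2) (γ : ZMod 2), (u, v) ∈ base.evenVirtualKernel ∧ p = (fun b => v b + γ, u) := by
  have h11 : (1 : ZMod 2) + 1 = 0 := by decide
  rw [mem_evenPencil_iff]
  constructor
  · rintro ⟨u, v, γ, hE1, hE2, rfl⟩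
    refine ⟨u, v, γ, (mem_evenVirtualKernel_iff base (u, v)).2 ⟨hE1, hE2⟩, Prod.ext ?_ ?_⟩
    · funext b; simp [h11]
    · funext b; simp [h11]
  · rintro ⟨u, v, γ, huv, rfl⟩
    obtain ⟨hE1, hE2⟩ := (mem_evenVirtualKernel_iff base (u, v)).1 huv
    refine ⟨u, v, γ, hE1, hE2, Prod.ext ?_ ?_⟩
    · funext b; simp [h11]
    · funext b; simp [h11]

/-- **MECHANISM (at most one prime `≡ 7 (mod 8)`).** If `(0, u)` lies in the even pencil at `δ = 1` and `⟨m,u⟩ = ⟨d,u⟩ = 0`, then `(u, 0)` lies in it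
too. (`(0,u) ∈ W_ev(1)` means `(u, γ·1) ∈ 𝒦_ev`; the column sums of the first kernel equations give `γ = ⟨m,u⟩ + ⟨d,u⟩ = 0`, then `u|_D = 0`,
`Lu = 0`, and — every prime `≡ 3 (mod 4)` but at most one being `≡ 3 (mod 8)`, the parity `⟨m,u⟩ = 0` — `u|_M = 0`, so `(0, u) ∈ 𝒦_ev` and `(u, 0) = T_1(0, u)`.)
[cite: HeathBrown1994SelmerCongruentII, Appendix (Monsky), typescript p. 41 L20–L36] -/
theorem swap_mem_evenPencil_one_inf_ker_snd_of_one_seven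
    (b₇ : Fin (k + 1)) (h71 : ∀ b, negNegOne (base.cls b) = true → negTwo (base.cls b) = false → b = b₇) (hμ : (∑ b, bz (negNegOne (base.cls b))) = 1)
    (p : (Fin (k + 1) → ZMod 2) × (Fin (k + 1) → ZMod 2))
    (hp : p ∈ base.evenPencil (fun _ => 1) ⊓ LinearMap.ker (LinearMap.fst (ZMod 2) (Fin (k + 1) → ZMod 2) (Fin (k + 1) → ZMod 2)))
    (hm : (∑ b, bz (negNegOne (base.cls b)) * p.2 b) = 0) (hd : (∑ b, bz (negTwo (base.cls b)) * p.2 b) = 0) :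
    ((p.2, 0) : (Fin (k + 1) → ZMod 2) × (Fin (k + 1) → ZMod 2)) ∈
      base.evenPencil (fun _ => 1) ⊓ LinearMap.ker (LinearMap.snd (ZMod 2) (Fin (k + 1) → ZMod 2) (Fin (k + 1) → ZMod 2)) := by
  have h2 : ∀ x : ZMod 2, x + x = 0 := by decide
  obtain ⟨hpW, hp0⟩ := Submodule.mem_inf.1 hp
  obtain ⟨u, v, γ, huv, rfl⟩ := (mem_evenPencil_one_iff₇ base p).1 hpW
  rw [LinearMap.mem_ker, LinearMap.fst_apply] at hp0
  have hv : ∀ b, v b = γ := fun b => by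
    have := congrFun hp0 b
    simp only [Pi.zero_apply] at this
    linear_combination this - h2 γ
  simp only at hm hd
  obtain ⟨hE1, hE2⟩ := (mem_evenVirtualKernel_iff base (u, v)).1 huv
  -- the two kernel equations of `(u, γ·1)` with `⟨m,u⟩ = 0`
  have e1 : ∀ i, (∑ j, bz (base.neg i j) * (u j + u i)) + bz (negTwo (base.cls i)) * u i + bz (negNegOne (base.cls i)) * γ = 0 :=
    fun i => by
    have e := hE1 i
    simp only [hm, hv, mul_zero, add_zero] at e
    exact e
  have e2 : ∀ i, bz (negTwo (base.cls i)) * u i + bz (negNegOne (base.cls i)) * γ + bz (negTwo (base.cls i)) * γ = 0 := fun i => by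
    have e := hE2 i
    simp only [hm, hv, mul_zero, add_zero, lap_const] at e
    linear_combination e
  -- column sums: `γ = ⟨d,u⟩ = 0`
  have hγ : γ = 0 := by
    have hs : (∑ i, ((∑ j, bz (base.neg i j) * (u j + u i)) + bz (negTwo (base.cls i)) * u i + bz (negNegOne (base.cls i)) * γ)) = 0 :=
      Finset.sum_eq_zero fun i _ => e1 i
    rw [Finset.sum_add_distrib, Finset.sum_add_distrib, sum_lap_eq_one_add_mu_mul₇ base u, hm, hd, ← Finset.sum_mul, hμ] at hs
    linear_combination hs
  have hdu : ∀ i, bz (negTwo (base.cls i)) * u i = 0 := fun i => by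
    have e := e2 i
    rw [hγ, mul_zero, mul_zero, add_zero, add_zero] at e
    exact e
  have hlap : ∀ i, (∑ j, bz (base.neg i j) * (u j + u i)) = 0 := fun i => by
    have e := e1 i
    rw [hγ, hdu i, mul_zero, add_zero, add_zero] at e
    exact e
  -- at most one prime `≡ 7 (mod 8)` and `⟨m,u⟩ = 0`: `u|_M = 0`
  have hmu' : ∀ i, i ≠ b₇ → bz (negNegOne (base.cls i)) * u i = 0 := fun i hi7 => by
    cases hi : negNegOne (base.cls i) with
    | false => exact zero_mul _
    | true =>
      cases hd : negTwo (base.cls i) with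
      | true => have := hdu i; rw [hd] at this; exact this
      | false => exact absurd (h71 i hi hd) hi7
  have hmu : ∀ i, bz (negNegOne (base.cls i)) * u i = 0 := fun i => by
    by_cases hi7 : i = b₇
    · have hs := hm
      rw [Finset.sum_eq_single b₇ (fun j _ hj => hmu' j hj) (fun h => absurd (Finset.mem_univ _) h)] at hs
      rw [hi7]; exact hs
    · exact hmu' i hi7
  -- `(0, u) ∈ 𝒦_ev`, so `(u, 0) ∈ W_ev(1)`
  have h0u : ((0 : Fin (k + 1) → ZMod 2), u) ∈ base.evenVirtualKernel := by
    rw [mem_evenVirtualKernel_iff]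
    refine ⟨fun i => ?_, fun i => ?_⟩
    · simp only [Pi.zero_apply, add_zero, mul_zero, Finset.sum_const_zero, zero_add]
      exact hmu i
    · simp only [Pi.zero_apply, mul_zero, Finset.sum_const_zero, zero_add, add_zero]
      linear_combination hlap i + hmu i + hdu i
  refine Submodule.mem_inf.2 ⟨?_, by rw [LinearMap.mem_ker, LinearMap.snd_apply]⟩
  rw [mem_evenPencil_one_iff₇]
  exact ⟨0, u, 0, h0u, Prod.ext (funext fun b => by simp) rfl⟩

/-- ★★ **(★) for bases with at most one prime `≡ 7 (mod 8)`, dimension form**: `2 · dim (W_ev(1) ∩ 0×V) ≤ dim 𝒦_ev + 1` (`= 2τ₀` by the kernel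
parity). The swap `(0,u) ↦ (u,0)` embeds the codimension-`≤ 2` part `{⟨m,u⟩ = ⟨d,u⟩ = 0}` of the `0 × V` section into the `V × 0` section and
misses its element `(1, 0)`; the two sections are disjoint in `W_ev(1)` (dimension `dim 𝒦_ev + 1`), and `dim 𝒦_ev` is odd.
[cite: HeathBrown1994SelmerCongruentII, Appendix (Monsky), typescript p. 41 L20–L36] -/
theorem two_mul_finrank_evenPencil_one_inf_ker_fst_le_of_one_seven
    (b₇ : Fin (k + 1)) (h71 : ∀ b, negNegOne (base.cls b) = true → negTwo (base.cls b) = false → b = b₇) (hμ : (∑ b, bz (negNegOne (base.cls b))) = 1) :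
    2 * finrank (ZMod 2) ↥(base.evenPencil (fun _ => 1) ⊓
        LinearMap.ker (LinearMap.fst (ZMod 2) (Fin (k + 1) → ZMod 2) (Fin (k + 1) → ZMod 2))) ≤
      finrank (ZMod 2) ↥base.evenVirtualKernel + 1 := by
  obtain ⟨b₀, hb₀⟩ := exists_negNegOne_of_sum_eq_one₇ base hμ
  set W := base.evenPencil (fun _ => 1) with hWdef
  set C := W ⊓ LinearMap.ker (LinearMap.fst (ZMod 2) (Fin (k + 1) → ZMod 2) (Fin (k + 1) → ZMod 2)) with hC
  set A := W ⊓ LinearMap.ker (LinearMap.snd (ZMod 2) (Fin (k + 1) → ZMod 2) (Fin (k + 1) → ZMod 2)) with hA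
  -- the two linear conditions `⟨m, p.2⟩ = 0`, `⟨d, p.2⟩ = 0`
  obtain ⟨φm, hφm⟩ := exists_dot_dual (k := k) (fun b => bz (negNegOne (base.cls b)))
  obtain ⟨φd, hφd⟩ := exists_dot_dual (k := k) (fun b => bz (negTwo (base.cls b)))
  set fm := φm.comp (LinearMap.snd (ZMod 2) (Fin (k + 1) → ZMod 2) (Fin (k + 1) → ZMod 2)) with hfm
  set fd := φd.comp (LinearMap.snd (ZMod 2) (Fin (k + 1) → ZMod 2) (Fin (k + 1) → ZMod 2)) with hfd
  set C₀ := (C ⊓ LinearMap.ker fm) ⊓ LinearMap.ker fd with hC₀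
  -- the swap
  set e := LinearEquiv.prodComm (ZMod 2) (Fin (k + 1) → ZMod 2) (Fin (k + 1) → ZMod 2) with he
  have hC₀A : C₀.map e.toLinearMap ≤ A := by
    intro q hq
    obtain ⟨p, hp, rfl⟩ := Submodule.mem_map.1 hq
    obtain ⟨hp1, hpd⟩ := Submodule.mem_inf.1 hp
    obtain ⟨hpC, hpm⟩ := Submodule.mem_inf.1 hp1
    have hp0 : p.1 = 0 := by
      have := (Submodule.mem_inf.1 hpC).2
      rwa [LinearMap.mem_ker, LinearMap.fst_apply] at this
    have hm : (∑ b, bz (negNegOne (base.cls b)) * p.2 b) = 0 := by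
      rw [LinearMap.mem_ker, hfm, LinearMap.comp_apply, LinearMap.snd_apply, hφm] at hpm
      exact hpm
    have hd : (∑ b, bz (negTwo (base.cls b)) * p.2 b) = 0 := by
      rw [LinearMap.mem_ker, hfd, LinearMap.comp_apply, LinearMap.snd_apply, hφd] at hpd
      exact hpd
    have hsw : e.toLinearMap p = (p.2, 0) := by
      rw [LinearEquiv.coe_toLinearMap, he, LinearEquiv.prodComm_apply, Prod.swap, hp0]
    rw [hsw]
    exact swap_mem_evenPencil_one_inf_ker_snd_of_one_seven base b₇ h71 hμ p hpC hm hd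
  -- `(1, 0) ∈ A` but not in the image of the swap (`⟨m, 1⟩ = μ = 1`)
  set x₁ : (Fin (k + 1) → ZMod 2) × (Fin (k + 1) → ZMod 2) := (fun _ => 1, 0) with hx₁
  have hx₁A : x₁ ∈ A := by
    refine Submodule.mem_inf.2 ⟨?_, by rw [LinearMap.mem_ker, LinearMap.snd_apply]⟩
    rw [mem_evenPencil_one_iff₇]
    exact ⟨0, 0, 1, base.evenVirtualKernel.zero_mem, Prod.ext (funext fun b => by simp [hx₁]) rfl⟩
  have hx₁0 : x₁ ≠ 0 := by
    intro h
    have := congrFun (congrArg Prod.fst h) 0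
    simp [hx₁] at this
  have hx₁not : x₁ ∉ C₀.map e.toLinearMap := by
    intro hx
    obtain ⟨p, hp, hpx⟩ := Submodule.mem_map.1 hx
    obtain ⟨hp1, -⟩ := Submodule.mem_inf.1 hp
    obtain ⟨-, hpm⟩ := Submodule.mem_inf.1 hp1
    rw [LinearMap.mem_ker, hfm, LinearMap.comp_apply, LinearMap.snd_apply, hφm] at hpm
    have hp2 : p.2 = fun _ => 1 := by
      have := congrArg Prod.fst hpx
      rw [LinearEquiv.coe_toLinearMap, he, LinearEquiv.prodComm_apply] at this
      simpa [hx₁] using this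
    rw [hp2] at hpm
    simp only [mul_one] at hpm
    rw [hμ] at hpm
    exact one_ne_zero hpm
  -- dimension count
  have hdis : C₀.map e.toLinearMap ⊓ Submodule.span (ZMod 2) {x₁} = ⊥ :=
    disjoint_iff.1 ((Submodule.disjoint_span_singleton' hx₁0).2 hx₁not)
  have hsum₁ := Submodule.finrank_sup_add_finrank_inf_eq (C₀.map e.toLinearMap) (Submodule.span (ZMod 2) {x₁})
  rw [hdis, finrank_bot, add_zero, finrank_span_singleton hx₁0,
    ← LinearEquiv.finrank_eq (Submodule.equivMapOfInjective _ e.injective C₀)] at hsum₁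
  have hle₁ : finrank (ZMod 2) ↥(C₀.map e.toLinearMap ⊔ Submodule.span (ZMod 2) {x₁}) ≤ finrank (ZMod 2) ↥A :=
    Submodule.finrank_mono (sup_le hC₀A ((Submodule.span_singleton_le_iff_mem _ _).2 hx₁A))
  have hcod₁ := finrank_le_finrank_inf_ker_add_one₇ C fm
  have hcod₂ : finrank (ZMod 2) ↥(C ⊓ LinearMap.ker fm) ≤ finrank (ZMod 2) ↥C₀ + 1 :=
    finrank_le_finrank_inf_ker_add_one₇ (C ⊓ LinearMap.ker fm) fd
  have hCA : C ⊓ A = ⊥ := by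
    rw [Submodule.eq_bot_iff]
    intro p hp
    obtain ⟨hpC, hpA⟩ := Submodule.mem_inf.1 hp
    have h1 : p.1 = 0 := by
      have := (Submodule.mem_inf.1 hpC).2
      rwa [LinearMap.mem_ker, LinearMap.fst_apply] at this
    have hp2 : p.2 = 0 := by
      have := (Submodule.mem_inf.1 hpA).2
      rwa [LinearMap.mem_ker, LinearMap.snd_apply] at this
    exact Prod.ext h1 hp2
  have hsup : C ⊔ A ≤ W := sup_le inf_le_left inf_le_left
  have hW : finrank (ZMod 2) ↥W = finrank (ZMod 2) ↥base.evenVirtualKernel + 1 :=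
    finrank_evenPencil_eq base (fun _ => 1) (evenPencil_one_legit base b₀ hb₀)
  have hsum := Submodule.finrank_sup_add_finrank_inf_eq C A
  rw [hCA, finrank_bot, add_zero] at hsum
  have hmono := Submodule.finrank_mono hsup
  obtain ⟨r, hr⟩ := odd_finrank_evenVirtualKernel base hμ
  omega

end OneSevenEven

end Summit.BirchSwinnertonDyer.BirchSwinnertonDyer.Theorems.SymbolicMonsky
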